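import Summits.QuantumFields.BalabanUV.Beta.SymRootedJetReflection
import Summits.QuantumFields.BalabanUV.Beta.RootedJetLinear

/-!
# `BalabanUV.Beta.SymRootedJetLinear` — ω-LINEARITY AND `Tau`-CENTRALITY OF THE (0.4)-SYMMETRISED ROOTED AVERAGED JET ON THE LEFT CHART WITH GENERAL
# BACKGROUND (`symQjetLAt`), hence of `symQjetAt` and `symT2At` (β sub-cell, row D1, TABLES-SYM-LEAN S2c, INTERFACE-LEVEL twin of an3-g33's `RootedJetLinear`; an1 gen 43)

HONEST FRAMING (cell charter, verbatim): «discharging BetaPertH makes Bałaban's UV stability UNCONDITIONAL — a real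
constructive-QFT result; it is NOT the continuum limit and NOT the Clay problem.»  HONEST DEPENDENCY (verbatim): «continuum YM on
T⁴ ⇐ BetaPertH ∧ nine spine estimates (0/9 proved); BetaPertH ⇐ (D1) ∧ (D4) ∧ CAP+tail; G-an2-4 gates asym, D1 and NE2/3/4.»
ABSOLUTE RULE (R-g25-7 ∕ R-D1-g30-1 (A)): the (0.4)-symmetrised averaging is the exp of the MEAN OF LOGS over the pair family
`{loop^{σ,σ′}}` with weight `((d!)²·L^d)⁻¹`; every object below is the comb module's algebra read on an1's `symPhiGAt` (S2b part 1)
instead of `PhiGAt` — STATEMENT FOR STATEMENT under the dictionary `PhiXAt ↦ symPhiXAt`, `XjetAt ↦ symXjetAt`, `MσXAt ↦ symMσXAt`,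
`L^{-d}·linAvgAt ↦ (d!·L^d)⁻¹·symLinU`, `L^{-d}·hessUAt ↦ ((d!)²L^d)⁻¹·symHessUAt`, `L^{-2d}·vhUAt ↦ ((d!)²L^{2d})⁻¹·symVhUAt`
(an3-g63 [AN3-G63-S2C] (C-ii): constants PER BCH ORDER; CONVENTION `(d!)²` un-normalised inside order-2 sym functionals).
FAMILY-INDEPENDENT chart ∕ letter ∕ `Tau`-algebra lemmas of the comb module are imported BY NAME, never re-proved.
DERIVED cell leaf: [folklore] ring algebra; the `sym*` families are [our object]s.  No statement of Bałaban's papers is typed here, no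
`[cite:]` tag, no `Prop` is minted, no binder of the β-function wall (`hW`/`hR`/`D1Tel`/`D1Rep`, (D1), `BetaPertH`) is instantiated or
discharged; nothing about the VALUES of `symMixFFAt`∕`symVh₂SAt` and no (T2-B)∕(T2-M₂) letter is discharged in this file.
NOT D1, NOT BetaPertH, NOT continuum, NOT Clay.  NOT summit progress.
Provenance: β sub-cell, TABLES-SYM-LEAN S2c option (C) (S2C-SCOPE-v1 94facb80ac685517), unit b2b-balaban-beta-an1-g43 (W-supplier AN1,
FREEZE (0): scratch for a courier; an1 files nothing), 2026-08-21; no existing file touched.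

## What this module proves (sym twin of `RootedJetLinear`; the two-letter lifts `GfL2`∕`GbL2` and their components are the comb module's, BY NAME)
* §1 CENTRALITY `symQjetLAt_mul_central` (`_τ₁_mul`, `_τ₂_mul`, `_τ12_mul`), `symQjetLAt_smul`.
* §2 ADDITIVITY `symQjetLAt_add` (`_zero`, `_neg`, `_sub`, `_sum`).
* §3 node 12b's chart: `symQjetAt_add_ω`∕`_neg_ω`∕`_sub_ω`∕`_mul_central`∕`_smul_ω`, `symT2At_add_ω`∕`_neg_ω`∕`_smul_ω`.
-/

namespace Summit.QuantumFields.BalabanUV.Beta.SymRootedJetLinear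

open Literature.MathematicalPhysics.QuantumFieldTheory.Balaban1983to89
open Literature.MathematicalPhysics.QuantumFieldTheory.Balaban1983to89.Beta
open AffineAveraging (Form1)
open AveragingThirdJet (Tau Rho dmk fst_dmk snd_dmk dfst_mul dsnd_mul mapDual fst_mapDual snd_mapDual scaleDual fst_scaleDual
  snd_scaleDual mergeDual fst_mergeDual snd_mergeDual Ebg Ebi logT invT map_logT map_invT)
open AveragingThirdJet.Tau (τ₁ τ₂ τ12 c11 c11_add c11_neg c11_smul τ₁_comm τ₂_comm τ12_comm)
open Summit.QuantumFields.BalabanUV.Beta.RootedJetReflection (GfL GbL fst_GfL snd_GfL fst_GbL snd_GbL)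
open Summit.QuantumFields.BalabanUV.Beta.RootedJetLinear (GfL2 GbL2 fst_GfL2 snd_GfL2 fst_GbL2 snd_GbL2)
open Summit.QuantumFields.BalabanUV.Beta.SymAveragingMixedJetTables (symPhiGAt map_symPhiGAt symQjetAt symT2At)
open Summit.QuantumFields.BalabanUV.Beta.SymRootedJetReflection (symPhiLAt symQjetLAt symQjetAt_eq_symQjetLAt)

variable {𝕜 : Type*} [Field 𝕜] {d : ℕ} {𝔸 : Type*} [Ring 𝔸] [Algebra 𝕜 𝔸]

/-! ## §1 Centrality -/

/-- [folklore] HOMOGENEITY of the rooted jet on the general-background chart under CENTRAL elements of `Tau 𝔸`. -/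
theorem symQjetLAt_mul_central (s : Tau 𝔸) (hs : ∀ t, s * t = t * s) (ρ : Fin d → ℤ) (ω E Eb : Form1 d (Tau 𝔸)) (L : ℕ)
    (μ : Fin d) (y : Fin d → ℤ) :
    symQjetLAt 𝕜 ρ (fun κ x => s * ω κ x) E Eb L μ y = s * symQjetLAt 𝕜 ρ ω E Eb L μ y := by
  have hG1 : ∀ κ x, scaleDual (𝕜 := 𝕜) s hs (GfL ω E κ x) = GfL (fun κ x => s * ω κ x) E κ x :=
    fun κ x => TrivSqZeroExt.ext (by simp) (by simp [mul_assoc])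
  have hG0 : ∀ κ x, scaleDual (𝕜 := 𝕜) s hs (GfL 0 E κ x) = GfL 0 E κ x :=
    fun κ x => TrivSqZeroExt.ext (by simp) (by simp)
  have hGb1 : ∀ κ x, scaleDual (𝕜 := 𝕜) s hs (GbL ω Eb κ x) = GbL (fun κ x => s * ω κ x) Eb κ x :=
    fun κ x => TrivSqZeroExt.ext (by simp)
      (by rw [snd_scaleDual, snd_GbL, snd_GbL, mul_neg, ← mul_assoc, hs, mul_assoc])
  have hGb0 : ∀ κ x, scaleDual (𝕜 := 𝕜) s hs (GbL 0 Eb κ x) = GbL 0 Eb κ x :=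
    fun κ x => TrivSqZeroExt.ext (by simp) (by simp)
  unfold symQjetLAt symPhiLAt
  have key := congrArg TrivSqZeroExt.snd (map_logT (scaleDual (𝕜 := 𝕜) s hs)
    (symPhiGAt 𝕜 ρ (GfL ω E) (GbL ω Eb) L μ y * invT (symPhiGAt 𝕜 ρ (GfL 0 E) (GbL 0 Eb) L μ y)))
  simp only [map_mul, map_invT, map_symPhiGAt, hG1, hG0, hGb1, hGb0, snd_scaleDual] at key
  exact key.symm

/-- [folklore] … in particular for `τ₁`. -/
theorem symQjetLAt_τ₁_mul (ρ : Fin d → ℤ) (ω E Eb : Form1 d (Tau 𝔸)) (L : ℕ) (μ : Fin d) (y : Fin d → ℤ) :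
    symQjetLAt 𝕜 ρ (fun κ x => τ₁ * ω κ x) E Eb L μ y = τ₁ * symQjetLAt 𝕜 ρ ω E Eb L μ y :=
  symQjetLAt_mul_central τ₁ τ₁_comm ρ ω E Eb L μ y

/-- [folklore] … for `τ₂`. -/
theorem symQjetLAt_τ₂_mul (ρ : Fin d → ℤ) (ω E Eb : Form1 d (Tau 𝔸)) (L : ℕ) (μ : Fin d) (y : Fin d → ℤ) :
    symQjetLAt 𝕜 ρ (fun κ x => τ₂ * ω κ x) E Eb L μ y = τ₂ * symQjetLAt 𝕜 ρ ω E Eb L μ y :=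
  symQjetLAt_mul_central τ₂ τ₂_comm ρ ω E Eb L μ y

/-- [folklore] … for `τ₁τ₂`. -/
theorem symQjetLAt_τ12_mul (ρ : Fin d → ℤ) (ω E Eb : Form1 d (Tau 𝔸)) (L : ℕ) (μ : Fin d) (y : Fin d → ℤ) :
    symQjetLAt 𝕜 ρ (fun κ x => τ12 * ω κ x) E Eb L μ y = τ12 * symQjetLAt 𝕜 ρ ω E Eb L μ y :=
  symQjetLAt_mul_central τ12 τ12_comm ρ ω E Eb L μ y

/-- [folklore] `𝕜`-HOMOGENEITY of the rooted jet on the general-background chart. -/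
theorem symQjetLAt_smul (r : 𝕜) (ρ : Fin d → ℤ) (ω E Eb : Form1 d (Tau 𝔸)) (L : ℕ) (μ : Fin d) (y : Fin d → ℤ) :
    symQjetLAt 𝕜 ρ (r • ω) E Eb L μ y = r • symQjetLAt 𝕜 ρ ω E Eb L μ y := by
  have h := symQjetLAt_mul_central (𝕜 := 𝕜) (algebraMap 𝕜 (Tau 𝔸) r) (fun t => Algebra.commutes r t) ρ ω E Eb L μ y
  simp only [← Algebra.smul_def] at h
  exact h

/-! ## §2 Additivity (the two-letter lifts `GfL2`∕`GbL2` are the comb module's, BY NAME) -/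

set_option synthInstance.maxHeartbeats 200000 in
set_option maxHeartbeats 1600000 in
/-- [folklore] **ADDITIVITY of the rooted jet in the fluctuation**, for any background letter pair. -/
theorem symQjetLAt_add (ρ : Fin d → ℤ) (ω₁ ω₂ E Eb : Form1 d (Tau 𝔸)) (L : ℕ) (μ : Fin d) (y : Fin d → ℤ) :
    symQjetLAt 𝕜 ρ (ω₁ + ω₂) E Eb L μ y = symQjetLAt 𝕜 ρ ω₁ E Eb L μ y + symQjetLAt 𝕜 ρ ω₂ E Eb L μ y := by
  have h2 : ∀ κ x, mapDual (TrivSqZeroExt.fstHom 𝕜 (Tau 𝔸) (Tau 𝔸)) (GfL2 ω₁ ω₂ E κ x) = GfL ω₂ E κ x :=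
    fun κ x => TrivSqZeroExt.ext (by simp) (by simp)
  have h2z : ∀ κ x, mapDual (TrivSqZeroExt.fstHom 𝕜 (Tau 𝔸) (Tau 𝔸)) (GfL2 0 0 E κ x) = GfL 0 E κ x :=
    fun κ x => TrivSqZeroExt.ext (by simp) (by simp)
  have h2b : ∀ κ x, mapDual (TrivSqZeroExt.fstHom 𝕜 (Tau 𝔸) (Tau 𝔸)) (GbL2 ω₁ ω₂ Eb κ x) = GbL ω₂ Eb κ x :=
    fun κ x => TrivSqZeroExt.ext (by simp) (by simp)
  have h2bz : ∀ κ x, mapDual (TrivSqZeroExt.fstHom 𝕜 (Tau 𝔸) (Tau 𝔸)) (GbL2 0 0 Eb κ x) = GbL 0 Eb κ x :=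
    fun κ x => TrivSqZeroExt.ext (by simp) (by simp)
  have h3 : ∀ κ x, mergeDual (𝕜 := 𝕜) (GfL2 ω₁ ω₂ E κ x) = GfL (ω₁ + ω₂) E κ x :=
    fun κ x => TrivSqZeroExt.ext (by simp) (by simp [add_mul])
  have h3z : ∀ κ x, mergeDual (𝕜 := 𝕜) (GfL2 0 0 E κ x) = GfL 0 E κ x :=
    fun κ x => TrivSqZeroExt.ext (by simp) (by simp)
  have h3b : ∀ κ x, mergeDual (𝕜 := 𝕜) (GbL2 ω₁ ω₂ Eb κ x) = GbL (ω₁ + ω₂) Eb κ x :=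
    fun κ x => TrivSqZeroExt.ext (by simp) (by
      rw [snd_mergeDual, fst_GbL2, snd_GbL2, snd_GbL, fst_dmk, snd_GbL, Pi.add_apply, Pi.add_apply, mul_add,
        neg_add])
  have h3bz : ∀ κ x, mergeDual (𝕜 := 𝕜) (GbL2 0 0 Eb κ x) = GbL 0 Eb κ x :=
    fun κ x => TrivSqZeroExt.ext (by simp) (by simp)
  unfold symQjetLAt symPhiLAt
  have k1 := congrArg TrivSqZeroExt.snd (map_logT (TrivSqZeroExt.fstHom 𝕜 (Rho 𝔸) (Rho 𝔸))
    (symPhiGAt 𝕜 ρ (GfL2 ω₁ ω₂ E) (GbL2 ω₁ ω₂ Eb) L μ y * invT (symPhiGAt 𝕜 ρ (GfL2 0 0 E) (GbL2 0 0 Eb) L μ y)))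
  simp only [map_mul, map_invT, map_symPhiGAt, TrivSqZeroExt.fstHom_apply, fst_GfL2, fst_GbL2] at k1
  have k2 := congrArg TrivSqZeroExt.snd (map_logT (mapDual (TrivSqZeroExt.fstHom 𝕜 (Tau 𝔸) (Tau 𝔸)))
    (symPhiGAt 𝕜 ρ (GfL2 ω₁ ω₂ E) (GbL2 ω₁ ω₂ Eb) L μ y * invT (symPhiGAt 𝕜 ρ (GfL2 0 0 E) (GbL2 0 0 Eb) L μ y)))
  simp only [map_mul, map_invT, map_symPhiGAt, h2, h2z, h2b, h2bz, snd_mapDual, TrivSqZeroExt.fstHom_apply] at k2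
  have k3 := congrArg TrivSqZeroExt.snd (map_logT (mergeDual (𝕜 := 𝕜))
    (symPhiGAt 𝕜 ρ (GfL2 ω₁ ω₂ E) (GbL2 ω₁ ω₂ Eb) L μ y * invT (symPhiGAt 𝕜 ρ (GfL2 0 0 E) (GbL2 0 0 Eb) L μ y)))
  simp only [map_mul, map_invT, map_symPhiGAt, h3, h3z, h3b, h3bz, snd_mergeDual] at k3
  exact k3.symm.trans (congrArg₂ HAdd.hAdd k1 k2)

/-- [folklore] The rooted jet of the zero fluctuation vanishes (any background). -/
@[simp] theorem symQjetLAt_zero (ρ : Fin d → ℤ) (E Eb : Form1 d (Tau 𝔸)) (L : ℕ) (μ : Fin d) (y : Fin d → ℤ) :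
    symQjetLAt 𝕜 ρ (0 : Form1 d (Tau 𝔸)) E Eb L μ y = 0 := by
  have h := symQjetLAt_add (𝕜 := 𝕜) ρ (0 : Form1 d (Tau 𝔸)) 0 E Eb L μ y
  rw [add_zero] at h
  exact left_eq_add.mp h

/-- [folklore] The rooted jet is odd in the fluctuation. -/
theorem symQjetLAt_neg (ρ : Fin d → ℤ) (ω E Eb : Form1 d (Tau 𝔸)) (L : ℕ) (μ : Fin d) (y : Fin d → ℤ) :
    symQjetLAt 𝕜 ρ (-ω) E Eb L μ y = -symQjetLAt 𝕜 ρ ω E Eb L μ y := by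
  have h := symQjetLAt_add (𝕜 := 𝕜) ρ (-ω) ω E Eb L μ y
  rw [neg_add_cancel, symQjetLAt_zero] at h
  exact (neg_eq_of_add_eq_zero_left h.symm).symm

/-- [folklore] The rooted jet is subtractive in the fluctuation. -/
theorem symQjetLAt_sub (ρ : Fin d → ℤ) (ω₁ ω₂ E Eb : Form1 d (Tau 𝔸)) (L : ℕ) (μ : Fin d) (y : Fin d → ℤ) :
    symQjetLAt 𝕜 ρ (ω₁ - ω₂) E Eb L μ y = symQjetLAt 𝕜 ρ ω₁ E Eb L μ y - symQjetLAt 𝕜 ρ ω₂ E Eb L μ y := by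
  rw [sub_eq_add_neg, symQjetLAt_add, symQjetLAt_neg, ← sub_eq_add_neg]

/-- [folklore] The rooted jet of a finite sum of fluctuations. -/
theorem symQjetLAt_sum {ι' : Type*} (s : Finset ι') (ω : ι' → Form1 d (Tau 𝔸)) (ρ : Fin d → ℤ) (E Eb : Form1 d (Tau 𝔸))
    (L : ℕ) (μ : Fin d) (y : Fin d → ℤ) :
    symQjetLAt 𝕜 ρ (∑ i ∈ s, ω i) E Eb L μ y = ∑ i ∈ s, symQjetLAt 𝕜 ρ (ω i) E Eb L μ y := by
  classical
  induction s using Finset.induction_on with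
  | empty => simp
  | insert i s hi ih => rw [Finset.sum_insert hi, Finset.sum_insert hi, symQjetLAt_add, ih]

/-! ## §3 Node 12b's chart: `symQjetAt` and `symT2At` -/

/-- [folklore] ADDITIVITY of node 12b's rooted jet `symQjetAt ρ` in the fluctuation. -/
theorem symQjetAt_add_ω (ρ : Fin d → ℤ) (ω₁ ω₂ : Form1 d (Tau 𝔸)) (B B' : Form1 d 𝔸) (L : ℕ) (μ : Fin d) (y : Fin d → ℤ) :
    symQjetAt 𝕜 ρ (ω₁ + ω₂) B B' L μ y = symQjetAt 𝕜 ρ ω₁ B B' L μ y + symQjetAt 𝕜 ρ ω₂ B B' L μ y := by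
  simp only [symQjetAt_eq_symQjetLAt, symQjetLAt_add]

/-- [folklore] The rooted jet is odd in the fluctuation. -/
theorem symQjetAt_neg_ω (ρ : Fin d → ℤ) (ω : Form1 d (Tau 𝔸)) (B B' : Form1 d 𝔸) (L : ℕ) (μ : Fin d) (y : Fin d → ℤ) :
    symQjetAt 𝕜 ρ (-ω) B B' L μ y = -symQjetAt 𝕜 ρ ω B B' L μ y := by
  simp only [symQjetAt_eq_symQjetLAt, symQjetLAt_neg]

/-- [folklore] … subtractive. -/
theorem symQjetAt_sub_ω (ρ : Fin d → ℤ) (ω₁ ω₂ : Form1 d (Tau 𝔸)) (B B' : Form1 d 𝔸) (L : ℕ) (μ : Fin d) (y : Fin d → ℤ) :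
    symQjetAt 𝕜 ρ (ω₁ - ω₂) B B' L μ y = symQjetAt 𝕜 ρ ω₁ B B' L μ y - symQjetAt 𝕜 ρ ω₂ B B' L μ y := by
  simp only [symQjetAt_eq_symQjetLAt, symQjetLAt_sub]

/-- [folklore] HOMOGENEITY of node 12b's rooted jet under central elements of `Tau 𝔸`. -/
theorem symQjetAt_mul_central (s : Tau 𝔸) (hs : ∀ t, s * t = t * s) (ρ : Fin d → ℤ) (ω : Form1 d (Tau 𝔸))
    (B B' : Form1 d 𝔸) (L : ℕ) (μ : Fin d) (y : Fin d → ℤ) :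
    symQjetAt 𝕜 ρ (fun κ x => s * ω κ x) B B' L μ y = s * symQjetAt 𝕜 ρ ω B B' L μ y := by
  simp only [symQjetAt_eq_symQjetLAt, symQjetLAt_mul_central s hs]

/-- [folklore] `𝕜`-homogeneity of node 12b's rooted jet. -/
theorem symQjetAt_smul_ω (r : 𝕜) (ρ : Fin d → ℤ) (ω : Form1 d (Tau 𝔸)) (B B' : Form1 d 𝔸) (L : ℕ) (μ : Fin d)
    (y : Fin d → ℤ) : symQjetAt 𝕜 ρ (r • ω) B B' L μ y = r • symQjetAt 𝕜 ρ ω B B' L μ y := by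
  simp only [symQjetAt_eq_symQjetLAt, symQjetLAt_smul]

/-- [folklore] ADDITIVITY of the symmetrised second-order response `symT2At ρ` in the fluctuation. -/
theorem symT2At_add_ω (ρ : Fin d → ℤ) (ω₁ ω₂ : Form1 d (Tau 𝔸)) (B B' : Form1 d 𝔸) (L : ℕ) (μ : Fin d) (y : Fin d → ℤ) :
    symT2At 𝕜 ρ (ω₁ + ω₂) B B' L μ y = symT2At 𝕜 ρ ω₁ B B' L μ y + symT2At 𝕜 ρ ω₂ B B' L μ y := by
  simp only [symT2At, symQjetAt_add_ω, c11_add]; abel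

/-- [folklore] `symT2At ρ` is odd in the fluctuation. -/
theorem symT2At_neg_ω (ρ : Fin d → ℤ) (ω : Form1 d (Tau 𝔸)) (B B' : Form1 d 𝔸) (L : ℕ) (μ : Fin d) (y : Fin d → ℤ) :
    symT2At 𝕜 ρ (-ω) B B' L μ y = -symT2At 𝕜 ρ ω B B' L μ y := by
  simp only [symT2At, symQjetAt_neg_ω, c11_neg]; abel

/-- [folklore] `𝕜`-homogeneity of `symT2At ρ` in the fluctuation. -/
theorem symT2At_smul_ω (r : 𝕜) (ρ : Fin d → ℤ) (ω : Form1 d (Tau 𝔸)) (B B' : Form1 d 𝔸) (L : ℕ) (μ : Fin d)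
    (y : Fin d → ℤ) : symT2At 𝕜 ρ (r • ω) B B' L μ y = r • symT2At 𝕜 ρ ω B B' L μ y := by
  simp only [symT2At, symQjetAt_smul_ω, c11_smul, smul_add]

end Summit.QuantumFields.BalabanUV.Beta.SymRootedJetLinear
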